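import Summits.ResolutionOfSingularities.ResolutionOfSingularities.Theorems.FrobeniusClosingClosingReductionTransportDict
import Summits.ResolutionOfSingularities.ResolutionOfSingularities.Theorems.FrobeniusClosingClosingReductionPairIsoKit
import Summits.ResolutionOfSingularities.ResolutionOfSingularities.Theorems.FrobeniusClosingClosingReductionArenaDefs
import Literature.AlgebraicGeometry.Resolution.PowerSeriesPBasis
import Literature.RingTheory.MvPowerSeries.MaximalIdealPow
import Literature.AlgebraicGeometry.Resolution.PowerSeriesRegularLocal

/-!
# Crux `ClosingReduction` — line `chart-factorization`, stub `stub_transport` (lead), part 2: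
# TRANSPORT OF SUCCESSOR POINTS along a pair isomorphism

`stub_transport (hK : PairIsoKit) : Transport`: over a perfect field `K` of characteristic `p`, if
`PairIso c c'` (`φ (ser c) = v^p · ser c' + g^p`) and `c` has multiplicity `p`, then every successor
`step i τ c` is pair-isomorphic to some successor `step i' τ' c'`.

Proof. (1) SERIES FORM OF A MOVE (`exists_chartMap_ser_eq`): for a multiplicity-`p` state `d`,
`σ_{i,τ}(ser d) = u_i^p · (ser (step i τ d) + h^p)` for some `h` — the route's `step` divides the
chart transform by `u_i^p` (the dictionary `transport_dictionary` of part 1 computes its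
coefficients) and deletes the `p`-th-power monomials, which over a perfect field form a `p`-th power
(`exists_pow_eq_of_forall_coeff`). (2) CHART FACTORIZATION (`stub_factorization`):
`σ_{i',τ'} ∘ φ = φ' ∘ σ_{i,τ}`. (3) BOOKKEEPING in characteristic `p`: `φ'(u_i) = u_{i'}·U` with `U`
a unit (an automorphism does not move `u_i` into `𝔪²`), `g ∈ 𝔪` (constant terms) so
`σ'(g) = u_{i'}·G`; applying `φ'` to (1) for `c`, `σ'` to the pair-isomorphism and (1) for `c'`,
and cancelling `u_{i'}^p`:
`φ'(ser c₁) = (U⁻¹σ'(v))^p · ser c₁' + (U⁻¹σ'(v)·h' + U⁻¹G − φ'(h))^p`.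

Helper namespace `…Theorems.FrobeniusClosing.TransportProof`.
-/

noncomputable section

-- single-problem summit: the doubled namespace component `ResolutionOfSingularities` is forced
set_option linter.dupNamespace false

open scoped BigOperators Classical
open MvPowerSeries IsLocalRing
open Literature.RingTheory.MvPowerSeries.Jets Literature.AlgebraicGeometry.Resolution

namespace Summit.ResolutionOfSingularities.ResolutionOfSingularities.Theorems.FrobeniusClosing

namespace TransportProof

variable {n : ℕ} {K : Type} [Field K] {p : ℕ}

/-! ### Small facts about the route's calculus -/

/-- Under `MultP` the step takes the `p`-branch. [folklore] -/
theorem step_eq_of_multP {c : (Fin n → ℕ) → K} (h : MultP p n K c) (i : Fin n) (τ : Fin n → K) :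
    step p n K i τ c = clean p n K (tr n K i τ p (dv n K i p (bl n K i (clean p n K c)))) := by
  unfold step
  rw [if_pos (ArenaProof.le_ord_clean_of_multP h)]

/-- `X i ^ k` is cancellable. [folklore] -/
theorem X_pow_mul_cancel (i : Fin n) (k : ℕ) {φ ψ : MvPowerSeries (Fin n) K}
    (h : X i ^ k * φ = X i ^ k * ψ) : φ = ψ := by
  induction k with
  | zero => simpa using h
  | succ k ih =>
    apply ih
    apply Literature.AlgebraicGeometry.Resolution.MvPowerSeries.X_mul_cancel (i := i)
    rw [← mul_assoc, ← mul_assoc, ← pow_succ', h]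

/-! ### (1) The series form of a move -/

/-- The chart transform of a cleaned series of multiplicity `p` has no monomial of `u_i`-degree `< p`.
[folklore] -/
theorem coeff_chartMap_ser_eq_zero {c : (Fin n → ℕ) → K} (h : MultP p n K c) (i : Fin n) (τ : Fin n → K)
    {B : Fin n →₀ ℕ} (hB : B i < p) : coeff B (chartMap n K i τ (ser p n K c)) = 0 := by
  rw [coeff_chartMap]
  refine Finset.sum_eq_zero fun A hA => ?_
  rw [Finset.mem_finsuppAntidiag] at hA
  have hdeg : A.degree < p := by
    rw [Finsupp.degree_eq_sum, hA.1]; exact hB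
  have h0 : coeff A (ser p n K c) = 0 := by
    by_contra hne
    exact absurd (((PairIsoKitProof.multP_iff c).1 h).2 A hne) (not_le.2 hdeg)
  rw [h0, zero_mul]

/-- **Series form of a move.** For a multiplicity-`p` state `d` over a perfect field of characteristic
`p`: `σ_{i,τ}(ser d) = u_i ^ p · (ser (step i τ d) + h ^ p)` for some series `h` (the deleted
`p`-th-power monomials). [folklore] -/
theorem exists_chartMap_ser_eq (hp : p.Prime) [CharP K p] [PerfectField K] {d : (Fin n → ℕ) → K}
    (hd : MultP p n K d) (i : Fin n) (τ : Fin n → K) :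
    ∃ h : MvPowerSeries (Fin n) K,
      chartMap n K i τ (ser p n K d) = X i ^ p * (ser p n K (step p n K i τ d) + h ^ p) := by
  haveI := Fact.mk hp
  -- the quotient series `Q = σ(ser d) / u_i^p`, by the route's formula
  set Q : MvPowerSeries (Fin n) K :=
    (show MvPowerSeries (Fin n) K from fun B : Fin n →₀ ℕ =>
      tr n K i τ p (dv n K i p (bl n K i (clean p n K d))) ⇑B) with hQ
  have hcoeffQ : ∀ B : Fin n →₀ ℕ,
      coeff B Q = coeff (Finsupp.equivFunOnFinite.symm (Function.update ⇑B i (B i + p)))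
        (chartMap n K i τ (ser p n K d)) := fun B => transport_dictionary p d i τ p ⇑B
  -- (a) `σ(ser d) = X i ^ p * Q`
  have hXQ : chartMap n K i τ (ser p n K d) = X i ^ p * Q := by
    ext B'
    rw [X_pow_eq, coeff_monomial_mul]
    by_cases hle : Finsupp.single i p ≤ B'
    · rw [if_pos hle, one_mul, hcoeffQ]
      congr 2
      symm
      rw [Equiv.symm_apply_eq]
      change _ = ⇑B'
      funext j
      by_cases hji : j = i
      · subst hji
        rw [Function.update_self]
        have : p ≤ B' j := by simpa using hle j
        simp only [Finsupp.coe_tsub, Pi.sub_apply, Finsupp.single_eq_same]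
        omega
      · rw [Function.update_of_ne hji]
        simp only [Finsupp.coe_tsub, Pi.sub_apply, Finsupp.single_apply, if_neg (Ne.symm hji), tsub_zero]
    · rw [if_neg hle]
      apply coeff_chartMap_ser_eq_zero hd
      by_contra hge
      push Not at hge
      apply hle
      intro j
      by_cases hji : j = i
      · subst hji; simpa using hge
      · simp only [Finsupp.single_apply, if_neg (Ne.symm hji), zero_le]
  -- (b) the `p`-th-power part `P` of `Q` and `ser (step i τ d) = Q - P`
  set P : MvPowerSeries (Fin n) K :=
    (show MvPowerSeries (Fin n) K from fun B : Fin n →₀ ℕ =>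
      if ∀ j, p ∣ B j then coeff B Q else 0) with hP
  have hcoeffP : ∀ B : Fin n →₀ ℕ, coeff B P = if ∀ j, p ∣ B j then coeff B Q else 0 := fun B => rfl
  have hstep : ser p n K (step p n K i τ d) = Q - P := by
    ext B
    rw [map_sub, hcoeffP, PairIsoKitProof.coeff_ser, step_eq_of_multP hd, ArenaProof.clean_clean]
    unfold clean
    split_ifs with hdiv
    · exact (sub_self _).symm
    · rw [sub_zero]; rfl
  -- (c) `P` is a `p`-th power over the perfect field `K`
  haveI : ExpChar K p := ExpChar.prime hp
  obtain ⟨h, hh⟩ : ∃ h : MvPowerSeries (Fin n) K, h ^ p = P := by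
    refine exists_pow_eq_of_forall_coeff p P (fun m => ?_) (fun m hm => ?_)
    · obtain ⟨b, hb⟩ := surjective_frobenius K p (coeff m P)
      exact ⟨b, by rw [← frobenius_def, hb]⟩
    · obtain ⟨j, hj⟩ := hm
      rw [hcoeffP, if_neg (fun hall => hj (hall j))]
  refine ⟨h, ?_⟩
  rw [hXQ, hstep, hh, sub_add_cancel]

/-! ### (3) Bookkeeping for the transport -/

/-- An automorphism of `K⟦u⟧` does not move a variable into `𝔪²`; hence if `φ'(u_i) = u_{i'}·U` then
`U` is a unit. [folklore] -/
theorem isUnit_of_algEquiv_X_eq (φ' : MvPowerSeries (Fin n) K ≃ₐ[K] MvPowerSeries (Fin n) K)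
    (i i' : Fin n) {U : MvPowerSeries (Fin n) K} (hU : φ' (X i) = X i' * U) : IsUnit U := by
  -- `φ' (X i) ∉ 𝔪 ^ 2`
  have hnot : φ' (X i) ∉ maximalIdeal (MvPowerSeries (Fin n) K) ^ 2 := by
    intro hmem
    have hX : (X i : MvPowerSeries (Fin n) K) ∈ maximalIdeal (MvPowerSeries (Fin n) K) ^ 2 := by
      have := algHom_apply_mem_maximalIdeal_pow (φ'.symm : MvPowerSeries (Fin n) K →ₐ[K] _) hmem
      simpa using this
    have h0 := coeff_eq_zero_of_mem_maximalIdeal_pow hX (e := Finsupp.single i 1)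
      (by rw [Finsupp.degree_single]; norm_num)
    rw [coeff_X, if_pos rfl] at h0
    exact one_ne_zero h0
  by_contra hU'
  apply hnot
  rw [hU, pow_two]
  refine Ideal.mul_mem_mul (mem_maximalIdeal_iff_constantCoeff_eq_zero.2 (constantCoeff_X i')) ?_
  rw [IsLocalRing.mem_maximalIdeal, mem_nonunits_iff]
  exact hU'

/-- In a pair isomorphism the additive part `g` has no constant term. [folklore] -/
theorem constantCoeff_eq_zero_of_pairIso (hp : p.Prime)
    (φ : MvPowerSeries (Fin n) K ≃ₐ[K] MvPowerSeries (Fin n) K) {c c' : (Fin n → ℕ) → K}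
    {v g : MvPowerSeries (Fin n) K} (h : φ (ser p n K c) = v ^ p * ser p n K c' + g ^ p) :
    constantCoeff g = 0 := by
  have h0 : ∀ c₀ : (Fin n → ℕ) → K, constantCoeff (ser p n K c₀) = 0 := fun c₀ => by
    rw [← coeff_zero_eq_constantCoeff_apply, PairIsoKitProof.coeff_ser]
    unfold clean
    rw [if_pos (fun j => by simp)]
  have hl : constantCoeff (φ (ser p n K c)) = 0 :=
    mem_maximalIdeal_iff_constantCoeff_eq_zero.1
      (algHom_apply_mem_maximalIdeal (φ : MvPowerSeries (Fin n) K →ₐ[K] _)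
        (mem_maximalIdeal_iff_constantCoeff_eq_zero.2 (h0 c)))
  rw [h, map_add, map_mul, map_pow, map_pow, h0 c', mul_zero, zero_add] at hl
  exact pow_eq_zero_iff hp.ne_zero |>.1 hl

/-! ### The transport -/

/-- **Transport of successor points** given chart factorization. [folklore] -/
theorem transport_of_factorization (hF : Factorization) (hK : PairIsoKit) : Transport := by
  intro p hp n hn K _ _ _ c c' hiso hc i τ
  haveI := Fact.mk hp
  haveI := PairIsoKitProof.charP_series (n := n) (K := K) p
  have hc' : MultP p n K c' := ((hK p hp n hn K).2.2 c c' hiso).2.1.1 hc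
  obtain ⟨φ, v, g, hv, hφ⟩ := hiso
  -- (2) chart factorization
  obtain ⟨i', τ', φ', hfac⟩ := hF n hn K φ i τ
  refine ⟨i', τ', ?_⟩
  -- (1) series form of the two moves
  obtain ⟨h₁, hh₁⟩ := exists_chartMap_ser_eq hp hc i τ
  obtain ⟨h₂, hh₂⟩ := exists_chartMap_ser_eq hp hc' i' τ'
  -- the chart map `σ'` as an algebra hom
  set σA : MvPowerSeries (Fin n) K →ₐ[K] MvPowerSeries (Fin n) K :=
    substAlgHom (FactorizationProof.hasSubst_chartSubst i' τ') with hσA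
  have hσ : ∀ f, chartMap n K i' τ' f = σA f := fun f => by
    rw [hσA, substAlgHom_apply]; rfl
  -- (3) bookkeeping: `φ'(u_i) = u_{i'} U`, `σ'(g) = u_{i'} G`
  obtain ⟨U, hU⟩ : X i' ∣ φ' (X i) := by
    rw [← FactorizationProof.chartMap_X_self i τ, ← hfac]
    exact FactorizationProof.X_dvd_chartMap i' τ' (constantCoeff_algHom_X (φ : _ →ₐ[K] _) i)
  have hUunit : IsUnit U := isUnit_of_algEquiv_X_eq φ' i i' hU
  obtain ⟨u, hu⟩ := hUunit
  obtain ⟨G, hG⟩ : X i' ∣ chartMap n K i' τ' g :=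
    FactorizationProof.X_dvd_chartMap i' τ' (constantCoeff_eq_zero_of_pairIso hp φ hφ)
  -- the master identity `φ'(σ(ser c)) = σ'(φ(ser c))`, expanded
  have hmaster : (X i' * U) ^ p * (φ' (ser p n K (step p n K i τ c)) + φ' h₁ ^ p) =
      σA v ^ p * (X i' ^ p * (ser p n K (step p n K i' τ' c') + h₂ ^ p)) + (X i' * G) ^ p := by
    have := hfac (ser p n K c)
    rw [hh₁, map_mul, map_pow, hU, map_add, map_pow, hφ, hσ, map_add, map_mul, map_pow, map_pow,
      ← hσ (ser p n K c'), hh₂, ← hσ g, hG] at this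
    exact this.symm
  -- cancel `u_{i'} ^ p`
  have hcancel : U ^ p * (φ' (ser p n K (step p n K i τ c)) + φ' h₁ ^ p) =
      σA v ^ p * (ser p n K (step p n K i' τ' c') + h₂ ^ p) + G ^ p := by
    apply X_pow_mul_cancel i' p
    rw [mul_pow, mul_pow] at hmaster
    linear_combination hmaster
  -- conclude
  set Ui : MvPowerSeries (Fin n) K := ↑u⁻¹ with hUi
  have hUiU : Ui * U = 1 := by rw [hUi, ← hu, Units.inv_mul]
  have hUiUp : Ui ^ p * U ^ p = 1 := by rw [← mul_pow, hUiU, one_pow]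
  refine ⟨φ', Ui * σA v, Ui * σA v * h₂ + Ui * G - φ' h₁,
    (Units.isUnit u⁻¹).mul (hv.map σA), ?_⟩
  rw [sub_pow_char, PairIsoKitProof.add_pow_p hp]
  linear_combination (Ui ^ p) * hcancel - (φ' (ser p n K (step p n K i τ c)) + φ' h₁ ^ p) * hUiUp

end TransportProof

/-- **STUB `stub_transport` (the lead's; registered signature).** Transport of successor points
along a pair isomorphism, from the pair-isomorphism kit (and the landed first lemma
`stub_factorization`). [folklore] -/
theorem stub_transport (hK : PairIsoKit) : Transport :=
  TransportProof.transport_of_factorization stub_factorization hK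

end Summit.ResolutionOfSingularities.ResolutionOfSingularities.Theorems.FrobeniusClosing

end
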